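import Literature.NumberTheory.EllipticCurves.ShimuraCurveHeegnerPointKolyvagin
import Literature.NumberTheory.Automorphic.ShimuraCurveRibetTakahashiComponentPackage
import Literature.NumberTheory.EllipticCurves.Rank1Residual.Predicates
import Summits.BirchSwinnertonDyer.Rank1Residual.X11b.RungK2Leaves
import Summits.BirchSwinnertonDyer.BirchSwinnertonDyer.Theses.ClassRecordThree

/-!
# BC3 skeleton (birth line) v3 for crux item stmt-BirchSwinnertonDyer-19899 `ShimuraKolyvaginOrderBoundAtThreeSurj` — a PROOF CUT replacing v1/v2's LOCUS CUT
(route decl `Summit.BirchSwinnertonDyer.BirchSwinnertonDyer.Theses.ClassRecordThree.ShimuraKolyvaginOrderBoundAtThreeSurj`; shared by K2@3 `ClassRecordThree`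
and KOLY `KolyvaginRoadThree`, RESIDUAL on both; planner `bsd-stepL-plan` g27, 2026-08-26, 23:1xZ).

WHY v3. v1 (0c45ac59) / v2 (e3c96ff7) cut the crux by the 3-ADIC IMAGE (stub A: `∀ n, ρ̄_{E,3ⁿ}` onto; stub B: the Elkies locus). Two seats
showed that cut IDLE on the cone: shim3b g2 (21:54Z, print side: everything printed for stub B's inputs is printed for every 3-adic image with
full mod-3 image) and shim-p2 g3 (p470429 `Theorems/ClassRecordThreeShimuraKolyvaginAdicImageOfRam.lean`, kernel side: `Surj W 3 → Ram W 3 →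
∀ n, W.HasSurjectiveModNGaloisRep (3 ^ n)` — a (ram) multiplicative prime gives a transvection at every level and the transvection form of
Serre's lifting lemma needs no `p ≥ 5`; GAP j260563: the one proper subgroup class of GL₂(ℤ/9) with full mod-3 image and full det (index 27,
Elkies) has no element of order 9), and BOTH `closes` apply the crux only at (ram) pairs (`…SurjSuffices.classRecordThree_shimuraUpperHalfAtThree_of_published_surj`
concludes `ClassX11b W 3 → Ram W 3 → ¬ShapeAlpha W → ¬ShapeGamma W → MissingUpperBoundAt W 3`). So stub B is EMPTY on the consumer locus and
stub A is the whole residual — a valid but uninformative skeleton. v3 cuts the PROOF instead, along the line the kernel already exhibits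
(shim3a g0, p468392 `Theorems/ClassRecordThreeShimuraKolyvaginOrderBoundAtThreeTransport.lean`): the ∀-form crux = [Kolyvagin's order bound at
ONE Gross–Zagier-displayed point of `X_{N⁺,N⁻}` — the literal ∃-shape of conjunct 4 of the Literature fact
`shimuraCurve_heegnerPoint_grossZagier_kolyvagin` = JSW 2017 Thm 4.4.1 / CST 2014 Thm 1.5, which the cell's D-AUDIT-19526c4 found NOT PRINTED at
`p = 3 ∣ N⁺`, `N⁻ > 1`] + [the rank-one TRANSPORT of the bound from one displayed non-torsion point to every displayed point].

* `stub_orderBoundSurj_heegnerPointAtThree` (H, LOAD-BEARING, NOT PRINTED): on the slice (`Surj W 3`, `3 ∣ N`, `S` even inert set, `3` split in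
  `K`) there is a displayed point `P` (`L′(E/K,1) = c_GZ · ĥ(P)/degS`, `ord₃ degS = ord₃ deg P₀`) carrying the bound
  `#Ш(E/K)[3^∞] ≤ 3^(2·ord₃[E(K):ℤP])` when non-torsion — verbatim the fact's conjunct shape at this locus, so a future printed theorem (or a
  Kolyvagin-system proof at full 3-adic image, which (ram) supplies by p470429) matches it literally. Why it might fail: at `p = 3 ∣ N⁺` the
  Heegner-class local conditions at `v ∣ 3` and the Čebotarev step at `p = 3` are unprinted for genuine Shimura curves (Howard 2004 and Kim
  2024 Thm 4.3 assume `p ∤ 6N` / `p ≥ 5`; Nekovář 2007 carries non-sharp error terms).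
* `stub_orderBoundSurj_transportAtThree` (T, PRINTED, kernel-proved MODULO two named facts): fact-free statement «two displays with the same
  `ord₃ degS`, the first carrying the bound ⇒ the second carries it» — p468392 proves exactly this from Gross–Zagier–Kolyvagin over `ℚ`
  (`rank_eq_analyticRank_of_analyticRank_le_one`, Darmon 2004 Thm 3.22, applied to `E` and `E^{(d_K)}`) and modularity
  (`WeierstrassCurve.hasEntireLFunction_rat`, BCDT 2001): `L′(E/K,1) ≠ 0 ⇒ rank E(K) = 1 ⇒ [E(K):ℤP]·… bookkeeping`
  (`card_sha_primaryComponent_le_of_two_displays`). As typed here (no fact binders) it stays OPEN in the kernel until those two facts are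
  proved or the route's glue feeds them; it is not the residual. Why it might fail: only through the two facts (printed).
* `_of` : H → T → crux (sorry-free; obtain the displayed bound-carrying point from H, transport to the crux's `P` by T).
* `stub_rung_orderBoundSurj_SEmptyAtThree` — BC5 rung, VERBATIM from v2 (name + text unchanged so its by-name landing p470552, seat shim-p2 g3,
  stays matched): the crux's own `S = ∅` case (X₀(N); Cha 2005 Thm 21 / Matar–Nekovář 2019 Thm 0.3) under three published-fact binders. LANDED.
Per-stub probes (H ↛ crux, H ↛ leaf, T ↛ crux, T ↛ leaf) in the planner's bc3probe-19899-{H,T}.lean (must FAIL; they do).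
[cite: JetchevSkinnerWan2017, Thm. 4.4.1 (p. 19)] [cite: CaiShuTian2014, Thm. 1.5] [cite: Darmon2004, Thm. 3.22, §3.9] [cite: BCDTJAMS2001, Thm. A]
[cite: Kolyvagin1990, Thm. A] [cite: Gross1991, Prop. 2.1, Thm. 2.3] [cite: Howard2004Duke, Thm. A] [cite: Kim2024TAMS, Thm. 4.3] [cite: Nekovar2007, §3]
[cite: Cha2005, Thm. 21] [cite: MatarNekovar2019, Thm. 0.3]
-/

noncomputable section

open scoped Classical

namespace Summit.BirchSwinnertonDyer.BirchSwinnertonDyer.Cruxes.ShimuraKolyvaginOrderBoundAtThreeSurj.Birth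

open NumberField CongruenceSubgroup Literature.NumberTheory.Automorphic
  Literature.NumberTheory.EllipticCurves.ModularForms
  Literature.NumberTheory.EllipticCurves

/-- stub H (LOAD-BEARING, NOT PRINTED at this locus): Kolyvagin's order bound at ONE Gross–Zagier-displayed point of the Shimura curve
`X_{N⁺,N⁻}` on the slice `Surj W 3`, `p = 3 ∣ N` — the literal ∃-shape of conjunct 4 of `shimuraCurve_heegnerPoint_grossZagier_kolyvagin`
(JSW 2017 Thm 4.4.1 / CST 2014 Thm 1.5) restricted to the residual locus (D-AUDIT-19526c4: not printed at `3 ∣ N⁺`, `N⁻ > 1`). On the cone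
(ram) gives the full 3-adic image (p470429), i.e. Kolyvagin's 1990 hypothesis. Why it might fail: the Heegner-class local conditions at `v ∣ 3`
and the Čebotarev step at `p = 3` on a genuine Shimura curve are unprinted (Howard 2004 / Kim 2024 Thm 4.3 need `p ∤ 6N` / `p ≥ 5`). -/
theorem stub_orderBoundSurj_heegnerPointAtThree :
  ∀ (W : WeierstrassCurve ℚ) [W.IsElliptic] [W.IsGloballyMinimal] (p : ℕ) [Fact p.Prime]
    (N : ℕ) [NeZero N] (K : Type) [Field K] [NumberField K] (S : Finset ℕ)
    (Dt : ModularParametrizationData W N)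
    (X : ShimuraCurveData (∏ q ∈ S, q) (N / ∏ q ∈ S, q))
    (W' : WeierstrassCurve ℚ) [W'.IsElliptic] (P₀ : ShimuraParametrizationData X W'),
    W.conductorNorm ℤ = N → Literature.NumberTheory.EllipticCurves.Rank1Residual.Surj W 3 →
    p ≠ 2 → W.HasIrreducibleModPGaloisRep p →
    IsImaginaryQuadratic K → Even S.card →
    (∀ ℓ ∈ S, ℓ.Prime ∧ ℓ ∣ N ∧ ¬ ℓ ^ 2 ∣ N ∧
      ((Ideal.span {(ℓ : ℤ)}).primesOver (𝓞 K)).ncard = 1 ∧ ¬ (ℓ : ℤ) ∣ NumberField.discr K) →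
    (∀ ℓ : ℕ, ℓ.Prime → ℓ ∣ N → ℓ ∉ S → ((Ideal.span {(ℓ : ℤ)}).primesOver (𝓞 K)).ncard = 2) →
    ((Ideal.span {(p : ℤ)}).primesOver (𝓞 K)).ncard = 2 →
    P₀.IsMinimalFor W →
    p ∣ N → p = 3 →
    ∃ (P : (W.baseChange K).toAffine.Point) (degS : ℕ), 0 < degS ∧
      padicValNat p degS = padicValNat p P₀.deg ∧
      LDerivEK W K =
          8 * (Real.pi : ℂ) ^ 2 * peterssonProduct (Gamma0 N) 2 Dt.f Dt.f /
              ((((Units.torsionOrder K : ℝ) / 2) ^ 2 * √|(NumberField.discr K : ℝ)| : ℝ) : ℂ) *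
            ((P.canonicalHeight : ℂ) / (degS : ℂ)) ∧
      (¬ IsOfFinAddOrder P →
        Nat.card (AddCommGroup.primaryComponent (W.baseChange K).sha p) ≤
            p ^ (2 * padicValNat p (AddSubgroup.zmultiples P).index)) := by
  sorry

/-- stub T (PRINTED; kernel-proved modulo two named facts by p468392): the rank-one TRANSPORT — two Gross–Zagier displays with the same
`ord₃ degS`, the first point carrying Kolyvagin's order bound when non-torsion, force the bound at the second (non-torsion) point. Fact-free as
typed: its kernel proof (`…Theorems…Transport`: `card_sha_primaryComponent_le_of_two_displays` + `mordellWeilRank_baseChange_eq_one_of_LDerivEK_ne_zero`)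
needs Gross–Zagier–Kolyvagin over `ℚ` for `E` and `E^{(d_K)}` (Darmon 2004 Thm 3.22) and modularity (BCDT 2001) as inputs. Why it might fail:
only through those two printed facts. -/
theorem stub_orderBoundSurj_transportAtThree :
  ∀ (W : WeierstrassCurve ℚ) [W.IsElliptic] [W.IsGloballyMinimal] (p : ℕ) [Fact p.Prime]
    (N : ℕ) [NeZero N] (K : Type) [Field K] [NumberField K] (S : Finset ℕ)
    (Dt : ModularParametrizationData W N)
    (X : ShimuraCurveData (∏ q ∈ S, q) (N / ∏ q ∈ S, q))
    (W' : WeierstrassCurve ℚ) [W'.IsElliptic] (P₀ : ShimuraParametrizationData X W'),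
    W.conductorNorm ℤ = N → Literature.NumberTheory.EllipticCurves.Rank1Residual.Surj W 3 →
    p ≠ 2 → W.HasIrreducibleModPGaloisRep p →
    IsImaginaryQuadratic K → Even S.card →
    (∀ ℓ ∈ S, ℓ.Prime ∧ ℓ ∣ N ∧ ¬ ℓ ^ 2 ∣ N ∧
      ((Ideal.span {(ℓ : ℤ)}).primesOver (𝓞 K)).ncard = 1 ∧ ¬ (ℓ : ℤ) ∣ NumberField.discr K) →
    (∀ ℓ : ℕ, ℓ.Prime → ℓ ∣ N → ℓ ∉ S → ((Ideal.span {(ℓ : ℤ)}).primesOver (𝓞 K)).ncard = 2) →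
    ((Ideal.span {(p : ℤ)}).primesOver (𝓞 K)).ncard = 2 →
    P₀.IsMinimalFor W →
    p ∣ N → p = 3 →
    ∀ (P₁ : (W.baseChange K).toAffine.Point) (degS₁ : ℕ) (P : (W.baseChange K).toAffine.Point) (degS : ℕ),
      0 < degS₁ → 0 < degS →
      padicValNat p degS₁ = padicValNat p P₀.deg → padicValNat p degS = padicValNat p P₀.deg →
      LDerivEK W K =
          8 * (Real.pi : ℂ) ^ 2 * peterssonProduct (Gamma0 N) 2 Dt.f Dt.f /
              ((((Units.torsionOrder K : ℝ) / 2) ^ 2 * √|(NumberField.discr K : ℝ)| : ℝ) : ℂ) *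
            ((P₁.canonicalHeight : ℂ) / (degS₁ : ℂ)) →
      LDerivEK W K =
          8 * (Real.pi : ℂ) ^ 2 * peterssonProduct (Gamma0 N) 2 Dt.f Dt.f /
              ((((Units.torsionOrder K : ℝ) / 2) ^ 2 * √|(NumberField.discr K : ℝ)| : ℝ) : ℂ) *
            ((P.canonicalHeight : ℂ) / (degS : ℂ)) →
      (¬ IsOfFinAddOrder P₁ →
        Nat.card (AddCommGroup.primaryComponent (W.baseChange K).sha p) ≤
            p ^ (2 * padicValNat p (AddSubgroup.zmultiples P₁).index)) →
      ¬ IsOfFinAddOrder P →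
        Nat.card (AddCommGroup.primaryComponent (W.baseChange K).sha p) ≤
            p ^ (2 * padicValNat p (AddSubgroup.zmultiples P).index) := by
  sorry

/-- plan-only BC5 rung (S = ∅, N⁻ = 1, the modular curve X₀(N)) of the RESTATED crux, in its own vocabulary: the crux text with `S = ∅ →` inserted after the `Surj` binder, under the three published-fact binders it rests on (conjuncts 1, 2, 19 of `PublishedInputsThree` ∕ of `PublishedInputsKolyThree.1`; none has a `_holds`): Gross–Zagier, Kolyvagin (rank one + Ш finite), Matar–Nekovář 2019 Thm 0.3 (= Cha 2005 Thm 21; d_K ∉ {−3, −4} is automatic from 3 split). PRINTED; closable BY NAME by `Summit.BirchSwinnertonDyer.BirchSwinnertonDyer.Theorems.ShimuraKolyvaginSurjRungSEmpty.stub_rung_orderBoundSurj_SEmptyAtThree` (seat shim-p2 g3, staged, gate dry-run ACCEPT; proof = the landed 19616 rung `…ShimuraKolyvaginRungSEmpty.stub_rung_orderBound_SEmptyAtThree_of_published`, p448259 ✓, which does not even use `Surj`); outside S's known regime (no printed p-part of BSD at p = 3 ∥ N). Not used by `_of`. -/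
theorem stub_rung_orderBoundSurj_SEmptyAtThree
    (hGZ : ∀ (N : ℕ) [NeZero N] (W : WeierstrassCurve ℚ) (K : Type) [Field K] [NumberField K],
      gross_zagier N W K)
    (hKol : ∀ (N : ℕ) [NeZero N] (W : WeierstrassCurve ℚ) (K : Type) [Field K] [NumberField K],
      kolyvagin N W K)
    (hMN : ∀ (N : ℕ) [NeZero N] (W : WeierstrassCurve ℚ) (K : Type) [Field K] [NumberField K],
      MatarNekovar2019.thm03_padicValNat_card_sha_le_of_irreducible N W K) :
  ∀ (W : WeierstrassCurve ℚ) [W.IsElliptic] [W.IsGloballyMinimal] (p : ℕ) [Fact p.Prime]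
    (N : ℕ) [NeZero N] (K : Type) [Field K] [NumberField K] (S : Finset ℕ)
    (Dt : ModularParametrizationData W N)
    (X : ShimuraCurveData (∏ q ∈ S, q) (N / ∏ q ∈ S, q))
    (W' : WeierstrassCurve ℚ) [W'.IsElliptic] (P₀ : ShimuraParametrizationData X W'),
    W.conductorNorm ℤ = N → Literature.NumberTheory.EllipticCurves.Rank1Residual.Surj W 3 → S = ∅ →
    p ≠ 2 → W.HasIrreducibleModPGaloisRep p →
    IsImaginaryQuadratic K → Even S.card →
    (∀ ℓ ∈ S, ℓ.Prime ∧ ℓ ∣ N ∧ ¬ ℓ ^ 2 ∣ N ∧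
      ((Ideal.span {(ℓ : ℤ)}).primesOver (𝓞 K)).ncard = 1 ∧ ¬ (ℓ : ℤ) ∣ NumberField.discr K) →
    (∀ ℓ : ℕ, ℓ.Prime → ℓ ∣ N → ℓ ∉ S → ((Ideal.span {(ℓ : ℤ)}).primesOver (𝓞 K)).ncard = 2) →
    ((Ideal.span {(p : ℤ)}).primesOver (𝓞 K)).ncard = 2 →
    P₀.IsMinimalFor W →
    p ∣ N → p = 3 →
    ∀ (P : (W.baseChange K).toAffine.Point) (degS : ℕ), 0 < degS →
      padicValNat p degS = padicValNat p P₀.deg →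
      LDerivEK W K =
        8 * (Real.pi : ℂ) ^ 2 * peterssonProduct (Gamma0 N) 2 Dt.f Dt.f /
            ((((Units.torsionOrder K : ℝ) / 2) ^ 2 * √|(NumberField.discr K : ℝ)| : ℝ) : ℂ) *
          ((P.canonicalHeight : ℂ) / (degS : ℂ)) →
      ¬ IsOfFinAddOrder P →
        Nat.card (AddCommGroup.primaryComponent (W.baseChange K).sha p) ≤
          p ^ (2 * padicValNat p (AddSubgroup.zmultiples P).index) := by
  sorry

/-! ## Stub statements by name -/

namespace Statement

/-- Statement of `stub_orderBoundSurj_heegnerPointAtThree`. -/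
abbrev stub_orderBoundSurj_heegnerPointAtThree : Prop := type_of% @Birth.stub_orderBoundSurj_heegnerPointAtThree
/-- Statement of `stub_orderBoundSurj_transportAtThree`. -/
abbrev stub_orderBoundSurj_transportAtThree : Prop := type_of% @Birth.stub_orderBoundSurj_transportAtThree
/-- Statement of `stub_rung_orderBoundSurj_SEmptyAtThree` (BC5 rung; LANDED p470552; not used by `_of`). -/
abbrev stub_rung_orderBoundSurj_SEmptyAtThree : Prop := type_of% @Birth.stub_rung_orderBoundSurj_SEmptyAtThree

end Statement

/-! ## The composition (sorry-free): H and T imply the crux, BY NAME -/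

theorem ShimuraKolyvaginOrderBoundAtThreeSurj_of (hH : Statement.stub_orderBoundSurj_heegnerPointAtThree)
    (hT : Statement.stub_orderBoundSurj_transportAtThree) :
    Summit.BirchSwinnertonDyer.BirchSwinnertonDyer.Theses.ClassRecordThree.ShimuraKolyvaginOrderBoundAtThreeSurj := by
  intro W _ _ p _ N _ K _ _ S Dt X W' _ P₀ hN hsurj hp2 hirr hK hS hin hsp hps hmin hpN hp3 P degS hdegS hval hdisp hPnt
  obtain ⟨P₁, degS₁, h0₁, hv₁, hdisp₁, hB₁⟩ :=
    hH W p N K S Dt X W' P₀ hN hsurj hp2 hirr hK hS hin hsp hps hmin hpN hp3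
  exact hT W p N K S Dt X W' P₀ hN hsurj hp2 hirr hK hS hin hsp hps hmin hpN hp3 P₁ degS₁ P degS h0₁ hdegS hv₁ hval
    hdisp₁ hdisp hB₁ hPnt

/-- The crux along this line, MODULO exactly the two registered stubs H and T (sorries live only in `stub_*`). -/
theorem ShimuraKolyvaginOrderBoundAtThreeSurj_proof :
    Summit.BirchSwinnertonDyer.BirchSwinnertonDyer.Theses.ClassRecordThree.ShimuraKolyvaginOrderBoundAtThreeSurj :=
  ShimuraKolyvaginOrderBoundAtThreeSurj_of stub_orderBoundSurj_heegnerPointAtThree stub_orderBoundSurj_transportAtThree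

end Summit.BirchSwinnertonDyer.BirchSwinnertonDyer.Cruxes.ShimuraKolyvaginOrderBoundAtThreeSurj.Birth

end
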